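import Summits.Ventures.CertifiedManyBodySolver.Theorems.ThermalStiffnessCeilingU8b8_le_7o44.Negative.LocalChargePinching
import Summits.Ventures.CertifiedManyBodySolver.Theorems.ThermalStiffnessCeilingU8b8_le_7o44.Negative.CurrentCovarianceNonVacuity
import HarnessLib

/-!
# `SectorPreserving` is redundant in the current-clustering hypothesis (negative-side helper for the cruxes K1′ / K1 of route `TcThermcert1`)

Disprover's helper (`--supports stmt-Ventures-24560`; crux K1′ `TcThermcert1.ThermalStiffnessCeilingU8b8_le_7o44`, line of record
`Cruxes/ThermalStiffnessCeilingU8b8_le_7o44/Lines/gauge_qbp_far_seam.lean` v1.6, bet C8 `stub_currentClustering8`; equally the K1 twin's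
C10): finding F9 of edition 4 of `Cruxes/ThermalStiffnessCeilingU8b8_le_7o44/Disproof.lean`, the torus corollary of `LocalChargePinching.lean`.

LOAD-BEARING ANALYSIS of Hypothesis C (`CurrentClustering U n β ξ` of the line): of its two hypotheses on the test observable `A` —
`A ∈ carEvenSubalgebra (orbSet X)` (even, local) and `SectorPreserving L (1−n) A` (no matrix element between the canonical `(N_L, S^z = 0)`
sector and its complement) — the SECOND IS REDUNDANT: Hypothesis C with it DELETED is EQUIVALENT to Hypothesis C, for every `U`, `n`, `β`, `ξ`
(`currentClusteringBody_iff_sectorFree`; constants `(C, k, L₀) ↦ (4·max C 0, k + 2, L₀)`). Given the constants for the sector-preserving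
class, apply the hypothesis to the local charge pinching `A₀` of an arbitrary even local `A` (even, local, sector preserving by
`LocalChargePinching`), whose covariance with the bond current EQUALS that of `A` (the sector blocks coincide) and whose norm is
`≤ (|X|+1)² ‖A‖ ≤ 4|X|² ‖A‖`; for the empty window `A` is a scalar and the covariance is `0` because `ω_p(j) = 0` (F1,
`gibbsState_fluxZeroBlock_farBond_eq_zero`). The statement is the line's `CurrentClustering U n β ξ ↔ (the same with SectorPreserving
deleted)` UNFOLDED (`sectorExpect`, `bondCurrent`, `SectorPreserving`, `sectorPred`, `FockOp`), checked by `exact` against the verbatim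
copies of the line's objects in the crux work file.

READING for the bet C8 / the lead: `CurrentClustering 8 (7/8) 8 ξ` says exactly "exponential clustering, uniform along `L → ∞`, of the
flux-free canonical Gibbs state at `β = 8` between the bond current and EVERY even local observable"; the sector bookkeeping of Hypothesis C
is cosmetic — a prover may assume `SectorPreserving` for free, a falsifier need not arrange it (only `ξ > 0`, the distance premise (F5) and
the stiffness-side guards (F2) are load-bearing).

HONEST FRAMING: finite-dimensional folklore; NO KILL of K1′, of stub B or of the bet C8 is claimed, nothing here bears on clustering at
`(U, n, β) = (8, 7/8, 8)`, and superconductivity in the Hubbard model is neither proved nor disproved by anything in this file.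
-/

noncomputable section

open scoped ComplexOrder ComplexConjugate Matrix.Norms.L2Operator
open Filter Topology Matrix Finset
open Literature.MathematicalPhysics.QuantumLattice
open Literature.Probability.LatticeModels
open Summit.Ventures.CertifiedManyBodySolver.Theorems.TcThermcert1.GaugeQbpFarSeam
open Summit.Ventures.CertifiedManyBodySolver.Theorems.TcThermcert1.CurrentCovarianceTRBlind
open Summit.Ventures.CertifiedManyBodySolver.Theorems.TcThermcert1.CurrentCovarianceLocality
open Summit.Ventures.CertifiedManyBodySolver.Theorems.TcThermcert1.CurrentCovarianceNonVacuity
open Summit.Ventures.CertifiedManyBodySolver.Theorems.TcThermcert1.LocalChargePinching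

namespace Summit.Ventures.CertifiedManyBodySolver.Theorems.TcThermcert1.CurrentClusteringSectorFree

/-! ## §3 Hypothesis C with and without `SectorPreserving` are equivalent -/

section Torus

/-- **F9 — `SectorPreserving` is redundant in Hypothesis C.** The line's `CurrentClustering U n β ξ`, unfolded (`sectorExpect`,
`bondCurrent`, `SectorPreserving`, `sectorPred`, `FockOp`; left side, checked `Iff.rfl`-equal to the copied definition in the crux work
file), is EQUIVALENT to the same statement with the hypothesis `SectorPreserving L (1 − n) A` DELETED (right side): given constants
`(C, k, L₀)` for the sector-preserving class, `(4·max C 0, k + 2, L₀)` serve for all even local observables — apply the hypothesis to the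
local pinching `A₀` (even, local, sector preserving), whose covariance with the current equals that of `A` and whose norm is
`≤ (|X|+1)² ‖A‖ ≤ 4|X|²‖A‖`; a scalar observable (`X = ∅`) has covariance `0` since `ω_p(j) = 0`. Every `U`, `n`, `β`, `ξ`. [folklore] -/
theorem currentClusteringBody_iff_sectorFree (U n β ξ : ℝ) :
    (0 < ξ ∧ ∃ C : ℝ, ∃ k L₀ : ℕ, ∀ (L : ℕ) [NeZero L], L₀ ≤ L →
        ∀ (X : Finset (FermionTorus 2 L)) (A : Matrix (Finset (Orb (FermionTorus 2 L))) (Finset (Orb (FermionTorus 2 L))) ℂ),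
          A ∈ carEvenSubalgebra (orbSet X) →
          (∀ s t : Finset (Orb (FermionTorus 2 L)),
            (s.card = 2 * ⌊(1 - (1 - n)) * (L : ℝ) ^ 2 / 2⌋₊ ∧
              2 * (s.filter fun i => (ofLex i).2 = 0).card = 2 * ⌊(1 - (1 - n)) * (L : ℝ) ^ 2 / 2⌋₊) →
            ¬ (t.card = 2 * ⌊(1 - (1 - n)) * (L : ℝ) ^ 2 / 2⌋₊ ∧
              2 * (t.filter fun i => (ofLex i).2 = 0).card = 2 * ⌊(1 - (1 - n)) * (L : ℝ) ^ 2 / 2⌋₊) →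
            A s t = 0 ∧ A t s = 0) →
          ∀ (X₀ y : ZMod L) (d : ℕ),
            (∀ x ∈ X, d ≤ torusDist x.toTorusSite ![X₀, y] ∧ d ≤ torusDist x.toTorusSite ![X₀ - 1, y]) →
            ‖gibbsState β ((hubbardTorusTT'Flux L 0 U 0).toBlock
                  (fun s => s.card = 2 * ⌊(1 - (1 - n)) * (L : ℝ) ^ 2 / 2⌋₊ ∧
                    2 * (s.filter fun i => (ofLex i).2 = 0).card = 2 * ⌊(1 - (1 - n)) * (L : ℝ) ^ 2 / 2⌋₊)
                  (fun s => s.card = 2 * ⌊(1 - (1 - n)) * (L : ℝ) ^ 2 / 2⌋₊ ∧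
                    2 * (s.filter fun i => (ofLex i).2 = 0).card = 2 * ⌊(1 - (1 - n)) * (L : ℝ) ^ 2 / 2⌋₊))
                ((A * (∑ σ : Fin 2,
                  ((-Complex.I) • (creation (orb (FermionTorus.ofTorusSite (![X₀, y] : TorusSite 2 L)) σ) *
                      annihilation (orb (FermionTorus.ofTorusSite (![X₀ - 1, y] : TorusSite 2 L)) σ)) +
                    Complex.I • (creation (orb (FermionTorus.ofTorusSite (![X₀ - 1, y] : TorusSite 2 L)) σ) *
                      annihilation (orb (FermionTorus.ofTorusSite (![X₀, y] : TorusSite 2 L)) σ))))).toBlock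
                  (fun s => s.card = 2 * ⌊(1 - (1 - n)) * (L : ℝ) ^ 2 / 2⌋₊ ∧
                    2 * (s.filter fun i => (ofLex i).2 = 0).card = 2 * ⌊(1 - (1 - n)) * (L : ℝ) ^ 2 / 2⌋₊)
                  (fun s => s.card = 2 * ⌊(1 - (1 - n)) * (L : ℝ) ^ 2 / 2⌋₊ ∧
                    2 * (s.filter fun i => (ofLex i).2 = 0).card = 2 * ⌊(1 - (1 - n)) * (L : ℝ) ^ 2 / 2⌋₊))
              - gibbsState β ((hubbardTorusTT'Flux L 0 U 0).toBlock
                  (fun s => s.card = 2 * ⌊(1 - (1 - n)) * (L : ℝ) ^ 2 / 2⌋₊ ∧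
                    2 * (s.filter fun i => (ofLex i).2 = 0).card = 2 * ⌊(1 - (1 - n)) * (L : ℝ) ^ 2 / 2⌋₊)
                  (fun s => s.card = 2 * ⌊(1 - (1 - n)) * (L : ℝ) ^ 2 / 2⌋₊ ∧
                    2 * (s.filter fun i => (ofLex i).2 = 0).card = 2 * ⌊(1 - (1 - n)) * (L : ℝ) ^ 2 / 2⌋₊))
                (A.toBlock
                  (fun s => s.card = 2 * ⌊(1 - (1 - n)) * (L : ℝ) ^ 2 / 2⌋₊ ∧
                    2 * (s.filter fun i => (ofLex i).2 = 0).card = 2 * ⌊(1 - (1 - n)) * (L : ℝ) ^ 2 / 2⌋₊)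
                  (fun s => s.card = 2 * ⌊(1 - (1 - n)) * (L : ℝ) ^ 2 / 2⌋₊ ∧
                    2 * (s.filter fun i => (ofLex i).2 = 0).card = 2 * ⌊(1 - (1 - n)) * (L : ℝ) ^ 2 / 2⌋₊))
                * gibbsState β ((hubbardTorusTT'Flux L 0 U 0).toBlock
                  (fun s => s.card = 2 * ⌊(1 - (1 - n)) * (L : ℝ) ^ 2 / 2⌋₊ ∧
                    2 * (s.filter fun i => (ofLex i).2 = 0).card = 2 * ⌊(1 - (1 - n)) * (L : ℝ) ^ 2 / 2⌋₊)
                  (fun s => s.card = 2 * ⌊(1 - (1 - n)) * (L : ℝ) ^ 2 / 2⌋₊ ∧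
                    2 * (s.filter fun i => (ofLex i).2 = 0).card = 2 * ⌊(1 - (1 - n)) * (L : ℝ) ^ 2 / 2⌋₊))
                ((∑ σ : Fin 2,
                  ((-Complex.I) • (creation (orb (FermionTorus.ofTorusSite (![X₀, y] : TorusSite 2 L)) σ) *
                      annihilation (orb (FermionTorus.ofTorusSite (![X₀ - 1, y] : TorusSite 2 L)) σ)) +
                    Complex.I • (creation (orb (FermionTorus.ofTorusSite (![X₀ - 1, y] : TorusSite 2 L)) σ) *
                      annihilation (orb (FermionTorus.ofTorusSite (![X₀, y] : TorusSite 2 L)) σ)))).toBlock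
                  (fun s => s.card = 2 * ⌊(1 - (1 - n)) * (L : ℝ) ^ 2 / 2⌋₊ ∧
                    2 * (s.filter fun i => (ofLex i).2 = 0).card = 2 * ⌊(1 - (1 - n)) * (L : ℝ) ^ 2 / 2⌋₊)
                  (fun s => s.card = 2 * ⌊(1 - (1 - n)) * (L : ℝ) ^ 2 / 2⌋₊ ∧
                    2 * (s.filter fun i => (ofLex i).2 = 0).card = 2 * ⌊(1 - (1 - n)) * (L : ℝ) ^ 2 / 2⌋₊))‖
              ≤ C * ‖A‖ * (X.card : ℝ) ^ k * Real.exp (-(d : ℝ) / ξ)) ↔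
    (0 < ξ ∧ ∃ C : ℝ, ∃ k L₀ : ℕ, ∀ (L : ℕ) [NeZero L], L₀ ≤ L →
        ∀ (X : Finset (FermionTorus 2 L)) (A : Matrix (Finset (Orb (FermionTorus 2 L))) (Finset (Orb (FermionTorus 2 L))) ℂ),
          A ∈ carEvenSubalgebra (orbSet X) →
          ∀ (X₀ y : ZMod L) (d : ℕ),
            (∀ x ∈ X, d ≤ torusDist x.toTorusSite ![X₀, y] ∧ d ≤ torusDist x.toTorusSite ![X₀ - 1, y]) →
            ‖gibbsState β ((hubbardTorusTT'Flux L 0 U 0).toBlock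
                  (fun s => s.card = 2 * ⌊(1 - (1 - n)) * (L : ℝ) ^ 2 / 2⌋₊ ∧
                    2 * (s.filter fun i => (ofLex i).2 = 0).card = 2 * ⌊(1 - (1 - n)) * (L : ℝ) ^ 2 / 2⌋₊)
                  (fun s => s.card = 2 * ⌊(1 - (1 - n)) * (L : ℝ) ^ 2 / 2⌋₊ ∧
                    2 * (s.filter fun i => (ofLex i).2 = 0).card = 2 * ⌊(1 - (1 - n)) * (L : ℝ) ^ 2 / 2⌋₊))
                ((A * (∑ σ : Fin 2,
                  ((-Complex.I) • (creation (orb (FermionTorus.ofTorusSite (![X₀, y] : TorusSite 2 L)) σ) *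
                      annihilation (orb (FermionTorus.ofTorusSite (![X₀ - 1, y] : TorusSite 2 L)) σ)) +
                    Complex.I • (creation (orb (FermionTorus.ofTorusSite (![X₀ - 1, y] : TorusSite 2 L)) σ) *
                      annihilation (orb (FermionTorus.ofTorusSite (![X₀, y] : TorusSite 2 L)) σ))))).toBlock
                  (fun s => s.card = 2 * ⌊(1 - (1 - n)) * (L : ℝ) ^ 2 / 2⌋₊ ∧
                    2 * (s.filter fun i => (ofLex i).2 = 0).card = 2 * ⌊(1 - (1 - n)) * (L : ℝ) ^ 2 / 2⌋₊)
                  (fun s => s.card = 2 * ⌊(1 - (1 - n)) * (L : ℝ) ^ 2 / 2⌋₊ ∧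
                    2 * (s.filter fun i => (ofLex i).2 = 0).card = 2 * ⌊(1 - (1 - n)) * (L : ℝ) ^ 2 / 2⌋₊))
              - gibbsState β ((hubbardTorusTT'Flux L 0 U 0).toBlock
                  (fun s => s.card = 2 * ⌊(1 - (1 - n)) * (L : ℝ) ^ 2 / 2⌋₊ ∧
                    2 * (s.filter fun i => (ofLex i).2 = 0).card = 2 * ⌊(1 - (1 - n)) * (L : ℝ) ^ 2 / 2⌋₊)
                  (fun s => s.card = 2 * ⌊(1 - (1 - n)) * (L : ℝ) ^ 2 / 2⌋₊ ∧
                    2 * (s.filter fun i => (ofLex i).2 = 0).card = 2 * ⌊(1 - (1 - n)) * (L : ℝ) ^ 2 / 2⌋₊))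
                (A.toBlock
                  (fun s => s.card = 2 * ⌊(1 - (1 - n)) * (L : ℝ) ^ 2 / 2⌋₊ ∧
                    2 * (s.filter fun i => (ofLex i).2 = 0).card = 2 * ⌊(1 - (1 - n)) * (L : ℝ) ^ 2 / 2⌋₊)
                  (fun s => s.card = 2 * ⌊(1 - (1 - n)) * (L : ℝ) ^ 2 / 2⌋₊ ∧
                    2 * (s.filter fun i => (ofLex i).2 = 0).card = 2 * ⌊(1 - (1 - n)) * (L : ℝ) ^ 2 / 2⌋₊))
                * gibbsState β ((hubbardTorusTT'Flux L 0 U 0).toBlock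
                  (fun s => s.card = 2 * ⌊(1 - (1 - n)) * (L : ℝ) ^ 2 / 2⌋₊ ∧
                    2 * (s.filter fun i => (ofLex i).2 = 0).card = 2 * ⌊(1 - (1 - n)) * (L : ℝ) ^ 2 / 2⌋₊)
                  (fun s => s.card = 2 * ⌊(1 - (1 - n)) * (L : ℝ) ^ 2 / 2⌋₊ ∧
                    2 * (s.filter fun i => (ofLex i).2 = 0).card = 2 * ⌊(1 - (1 - n)) * (L : ℝ) ^ 2 / 2⌋₊))
                ((∑ σ : Fin 2,
                  ((-Complex.I) • (creation (orb (FermionTorus.ofTorusSite (![X₀, y] : TorusSite 2 L)) σ) *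
                      annihilation (orb (FermionTorus.ofTorusSite (![X₀ - 1, y] : TorusSite 2 L)) σ)) +
                    Complex.I • (creation (orb (FermionTorus.ofTorusSite (![X₀ - 1, y] : TorusSite 2 L)) σ) *
                      annihilation (orb (FermionTorus.ofTorusSite (![X₀, y] : TorusSite 2 L)) σ)))).toBlock
                  (fun s => s.card = 2 * ⌊(1 - (1 - n)) * (L : ℝ) ^ 2 / 2⌋₊ ∧
                    2 * (s.filter fun i => (ofLex i).2 = 0).card = 2 * ⌊(1 - (1 - n)) * (L : ℝ) ^ 2 / 2⌋₊)
                  (fun s => s.card = 2 * ⌊(1 - (1 - n)) * (L : ℝ) ^ 2 / 2⌋₊ ∧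
                    2 * (s.filter fun i => (ofLex i).2 = 0).card = 2 * ⌊(1 - (1 - n)) * (L : ℝ) ^ 2 / 2⌋₊))‖
              ≤ C * ‖A‖ * (X.card : ℝ) ^ k * Real.exp (-(d : ℝ) / ξ)) := by
  constructor
  · rintro ⟨hξ, C, k, L₀, h⟩
    refine ⟨hξ, 4 * max C 0, k + 2, L₀, fun L _ hL X A hA X₀ y d hd => ?_⟩
    by_cases hX : X = ∅
    · -- a scalar observable: `𝔄_even(orbSet ∅) = ⊥`, and `ω_p(j) = 0` (F1)
      subst hX
      obtain ⟨c, hc⟩ := exists_mul_eq_smul_of_mem_carEvenSubalgebra_orbSet_empty hA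
      rw [hc, toBlock_smul_eq, map_smul, gibbsState_fluxZeroBlock_farBond_eq_zero L U β X₀ y, smul_zero, mul_zero,
        sub_zero, norm_zero]
      positivity
    · have hXne : X.Nonempty := Finset.nonempty_iff_ne_empty.2 hX
      have hAcar : A ∈ carSubalgebra (orbSet X) := carEvenSubalgebra_le_carSubalgebra _ hA
      -- Hypothesis C applied to the local pinching `A₀` of `A` (even, local, sector preserving)
      have hb := h L hL X _ (locPinch_mem hA)
        (sectorPreserving_of_preservesSectors (preservesSectors_locPinch hAcar) _) X₀ y d hd
      have hJ := farBond_sectorPreserving (FermionTorus.ofTorusSite (![X₀, y] : TorusSite 2 L))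
        (FermionTorus.ofTorusSite (![X₀ - 1, y] : TorusSite 2 L)) ⌊(1 - (1 - n)) * (L : ℝ) ^ 2 / 2⌋₊
      -- the covariances of `A₀` and `A` with the current coincide
      rw [toBlock_locPinch_mul_eq hAcar _ hJ, toBlock_locPinch_eq hAcar] at hb
      refine hb.trans ?_
      -- `‖A₀‖ ≤ (|X|+1)² ‖A‖ ≤ 4|X|² ‖A‖`
      have hnorm := norm_locPinch_le X A
      have hcard : ((X.card : ℝ) + 1) ^ 2 ≤ 4 * (X.card : ℝ) ^ 2 := by
        have h1 : (1 : ℝ) ≤ X.card := by exact_mod_cast hXne.card_pos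
        nlinarith
      have h3 := mul_le_mul (le_max_left C 0) (hnorm.trans (mul_le_mul_of_nonneg_right hcard (norm_nonneg A)))
        (norm_nonneg _) (le_max_right C 0)
      calc _ ≤ max C 0 * (4 * (X.card : ℝ) ^ 2 * ‖A‖) * (X.card : ℝ) ^ k * Real.exp (-(d : ℝ) / ξ) :=
            mul_le_mul_of_nonneg_right (mul_le_mul_of_nonneg_right h3 (by positivity)) (by positivity)
        _ = 4 * max C 0 * ‖A‖ * (X.card : ℝ) ^ (k + 2) * Real.exp (-(d : ℝ) / ξ) := by ring
  · rintro ⟨hξ, C, k, L₀, h⟩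
    exact ⟨hξ, C, k, L₀, fun L _ hL X A hA _ X₀ y d hd => h L hL X A hA X₀ y d hd⟩

end Torus

end Summit.Ventures.CertifiedManyBodySolver.Theorems.TcThermcert1.CurrentClusteringSectorFree

end
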